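import Summits.QuantumFields.YangMills.Theorems.CoarseStiffnessTailCappedCoarseStiffnessLPivotPeeling

/-!
# Route `CoarseStiffnessTail` — PEELING WITH A SPECTATOR: `∫ Π_𝔉 φ_β(U(∂p))·G(U) dU ≤ linkMass(β)^{#𝔉}·∫ G dU` when `G` does not see the pivots
# (lead's certificate, seat `ym-line-cst-p1` g15; helper on 25301 `CappedCoarseStiffnessL`, stub S3 = uniform mean action)

THE THEOREM (`lintegral_prodPlaqFactor_mul_le_of_peelable`, any regular gauge group, any `Params`).  Let `(𝔉, piv, ρ)` be a peelable family
(pivots are links, injective, private in order — as in `…LPivotPeeling`) and `G : GaugeField → ℝ≥0∞` measurable with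
`G(U[piv p ↦ V]) = G(U)` for every `p ∈ 𝔉` (the spectator does not depend on the pivot variables).  Then
`∫⁻ (Π_{p∈𝔉} φ_β(U(∂p)))·G(U) dU ≤ linkMassE(β)^{#𝔉} · ∫⁻ G dU`; in particular (`boltzmann_mul_le`) for `0 ≤ β` and any such `G`:
`∫ e^{−βA(U)}·G(U) dU ≤ linkMass(β)^{#𝔉}·∫ G dU` in the form `∫⁻ ofReal(e^{−βA})·G ≤ linkMassE^{#𝔉}·∫⁻ G`.

PROOF.  Same peeling as `…LPivotPeeling` (member of minimal rank first, `lmarginal_insert'`): the marginal over the pivots of `Π_A φ·G` is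
`linkMassE^{#A}·G` (the spectator factors out of each pivot integral), then `lintegral_le_of_lmarginal_le`... here with EQUALITY of marginals,
and the remaining integral is `∫⁻ G`.

WHY (line card §g15, P2).  The sharp UPPER bound on Bałaban's torus partition function keeps, besides the corner-comb family, the factor
`exp(−(β/2)·D(U))` where `D` is the commutator defect of the `d` corner cycles — free bonds of the family; this file lets that factor ride
through the peeling, leaving the finite-dimensional integral `J(s) = ∫_{G^d} e^{−s Σ_{k<l}(1 − Re tr[g_k, g_l])} dg`.

HONEST SCOPE.  Kernel measure theory; nothing of Bałaban's is asserted; the crux 25301, its stubs S1/S2/S3, `HistoryTailL` 19936 stay OPEN;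
`YM3TorusSU2` (R3, RECORD rung, not Clay) is NOT proved; the Yang–Mills mass gap is NOT touched.

References: I. Montvay, G. Münster, *Quantum Fields on a Lattice* (1994) §3.2.5 [MontvayMunster1994]; T. Bałaban, CMP **102** (1985) 255–275
[Balaban1985UV3] ((1)–(3) p.256).
-/

noncomputable section

open MeasureTheory
open scoped ENNReal BigOperators

namespace Summit.QuantumFields.YangMills.Theorems.CoarseStiffnessTailSpectatorPeeling

open Literature.MathematicalPhysics.QuantumFieldTheory.Balaban1983to89 Literature.MathematicalPhysics.QuantumFieldTheory.Balaban1983to89.Missing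
open Summit.QuantumFields.BalabanUV.T4Continuum.NE7b.BarePartitionFnDecay
  (plaqFactor plaqFactor_pos linkMass linkMassE linkMass_nonneg linkMassE_eq_ofReal linkMassE_ne_top
    measurable_plaqFactor boltzmann_le_prod)
open Summit.QuantumFields.YangMills.BalabanUVNodes.N13WilsonPartitionFnAxialTreeUpperBound (measurable_prodPlaqFactor)
open Summit.QuantumFields.YangMills.Theorems.CoarseStiffnessTailPivotPeeling (plaqHol_update_of_not_link lintegral_plaqFactor_update_link)

variable {G : Type*} [GaugeGroup G] [MeasurableSpace G] [HaarData G]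
variable (P : Params) [RegularGaugeGroup G] [DecidableEq (PBond P 0)]

/-- **★★ THE MARGINAL OVER THE PIVOTS WITH A SPECTATOR**: for a peelable family `(𝔉, piv, ρ)` and a measurable `Gs` invariant under updating
any pivot of `𝔉`, for every `A ⊆ 𝔉`:
`∫⋯∫⁻_{piv(A)} (Π_{p∈A} φ_β(U(∂p)))·Gs(U) = linkMassE β ^ #A · Gs(U)`. [folklore] -/
theorem lmarginal_prodPlaqFactor_mul_eq_of_peelable (β : ℝ) (𝔉 : Finset (Plaq P 0)) (piv : Plaq P 0 → PBond P 0)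
    (ρ : Plaq P 0 → ℕ)
    (hlink : ∀ p ∈ 𝔉, piv p = ⟨p.src, p.μ⟩ ∨ piv p = ⟨p.src.shift p.μ, p.ν⟩ ∨ piv p = ⟨p.src.shift p.ν, p.μ⟩ ∨ piv p = ⟨p.src, p.ν⟩)
    (hinj : Set.InjOn piv (𝔉 : Set (Plaq P 0)))
    (hpriv : ∀ p ∈ 𝔉, ∀ q ∈ 𝔉, p ≠ q →
      (piv q = ⟨p.src, p.μ⟩ ∨ piv q = ⟨p.src.shift p.μ, p.ν⟩ ∨ piv q = ⟨p.src.shift p.ν, p.μ⟩ ∨ piv q = ⟨p.src, p.ν⟩) → ρ p < ρ q)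
    (Gs : GaugeField P 0 G → ℝ≥0∞) (hGm : Measurable Gs) (hGs : ∀ p ∈ 𝔉, ∀ (U : GaugeField P 0 G) (V : G), Gs (Function.update U (piv p) V) = Gs U) :
    ∀ (n : ℕ) (A : Finset (Plaq P 0)), A.card = n → A ⊆ 𝔉 →
      (∫⋯∫⁻_(A.image piv), (fun U : GaugeField P 0 G => (∏ p ∈ A, ENNReal.ofReal (plaqFactor β (GaugeField.plaqHol U p))) * Gs U)
          ∂(fun _ : PBond P 0 => (HaarData.haar : Measure G))) = fun U => linkMassE (G := G) β ^ n * Gs U := by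
  classical
  haveI : IsProbabilityMeasure (HaarData.haar (G := G)) := HaarData.isProb
  intro n
  induction n with
  | zero =>
    intro A hA _
    rw [Finset.card_eq_zero] at hA
    subst hA
    ext U
    simp
  | succ n ih =>
    intro A hA hA𝔉
    have hne : A.Nonempty := by rw [← Finset.card_pos, hA]; exact Nat.succ_pos n
    obtain ⟨q, hqA, hqmin⟩ := Finset.exists_min_image A ρ hne
    have hq𝔉 : q ∈ 𝔉 := hA𝔉 hqA
    set A' : Finset (Plaq P 0) := A.erase q with hA'def
    have hqA' : q ∉ A' := Finset.notMem_erase q A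
    have hAeq : A = insert q A' := (Finset.insert_erase hqA).symm
    have hA'card : A'.card = n := by rw [hA'def, Finset.card_erase_of_mem hqA, hA]; omega
    have hA'𝔉 : A' ⊆ 𝔉 := fun p hp => hA𝔉 (Finset.mem_of_mem_erase hp)
    have hnot : piv q ∉ A'.image piv := by
      rw [Finset.mem_image]
      rintro ⟨p, hp, hpe⟩
      have hpq : p = q := hinj (hA'𝔉 hp) hq𝔉 hpe
      exact hqA' (hpq ▸ hp)
    have hprivate : ∀ p ∈ A', piv q ≠ ⟨p.src, p.μ⟩ ∧ piv q ≠ ⟨p.src.shift p.μ, p.ν⟩ ∧ piv q ≠ ⟨p.src.shift p.ν, p.μ⟩ ∧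
        piv q ≠ ⟨p.src, p.ν⟩ := by
      intro p hp
      have hpA : p ∈ A := Finset.mem_of_mem_erase hp
      have hne : p ≠ q := Finset.ne_of_mem_erase hp
      have hle : ρ q ≤ ρ p := hqmin p hpA
      by_contra hcon
      have hor : piv q = ⟨p.src, p.μ⟩ ∨ piv q = ⟨p.src.shift p.μ, p.ν⟩ ∨ piv q = ⟨p.src.shift p.ν, p.μ⟩ ∨ piv q = ⟨p.src, p.ν⟩ := by
        tauto
      have hlt := hpriv p (hA'𝔉 hp) q hq𝔉 hne hor
      omega
    have hmeasF : Measurable fun U : GaugeField P 0 G =>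
        (∏ p ∈ insert q A', ENNReal.ofReal (plaqFactor β (GaugeField.plaqHol U p))) * Gs U :=
      (measurable_prodPlaqFactor P β _).mul hGm
    rw [hAeq, Finset.image_insert, lmarginal_insert' _ hmeasF hnot]
    have hinner : (fun U : PBond P 0 → G => ∫⁻ V, ((∏ p ∈ insert q A', ENNReal.ofReal (plaqFactor β
        (GaugeField.plaqHol (Function.update U (piv q) V) p))) * Gs (Function.update U (piv q) V)) ∂(HaarData.haar : Measure G)) =
        fun U => linkMassE (G := G) β * ((∏ p ∈ A', ENNReal.ofReal (plaqFactor β (GaugeField.plaqHol U p))) * Gs U) := by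
      ext U
      have hrew : ∀ V : G, ((∏ p ∈ insert q A', ENNReal.ofReal (plaqFactor β
          (GaugeField.plaqHol (Function.update U (piv q) V) p))) * Gs (Function.update U (piv q) V)) =
          ENNReal.ofReal (plaqFactor β (GaugeField.plaqHol (Function.update U (piv q) V) q)) *
            ((∏ p ∈ A', ENNReal.ofReal (plaqFactor β (GaugeField.plaqHol U p))) * Gs U) := by
        intro V
        rw [Finset.prod_insert hqA', hGs q hq𝔉 U V, mul_assoc]
        congr 2
        refine Finset.prod_congr rfl fun p hp => ?_
        obtain ⟨h1, h2, h3, h4⟩ := hprivate p hp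
        rw [plaqHol_update_of_not_link P U V p (piv q) h1 h2 h3 h4]
      simp_rw [hrew]
      have hmeas : Measurable fun V : G =>
          ENNReal.ofReal (plaqFactor β (GaugeField.plaqHol (Function.update U (piv q) V) q)) := by
        refine ((measurable_plaqFactor β).comp ?_).ennreal_ofReal
        exact (measurable_plaqHol q).comp (measurable_update U)
      rw [lintegral_mul_const _ hmeas, lintegral_plaqFactor_update_link P β U q (piv q) (hlink q hq𝔉), mul_comm]
    rw [hinner]
    ext U
    have hmeasF' : Measurable fun U : GaugeField P 0 G =>
        (∏ p ∈ A', ENNReal.ofReal (plaqFactor β (GaugeField.plaqHol U p))) * Gs U :=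
      (measurable_prodPlaqFactor P β _).mul hGm
    have hih := congrFun (ih A' hA'card hA'𝔉) U
    simp only [lmarginal] at hih ⊢
    rw [lintegral_const_mul' _ _ (linkMassE_ne_top β), hih, pow_succ]
    ring

omit [RegularGaugeGroup G] in
/-- A function invariant under updating the coordinates of `s` is its own marginal over `s` (probability measures). [folklore] -/
theorem lmarginal_eq_self_of_invariant (s : Finset (PBond P 0)) (g : (PBond P 0 → G) → ℝ≥0∞) (hg : Measurable g)
    (hinv : ∀ b ∈ s, ∀ (U : PBond P 0 → G) (V : G), g (Function.update U b V) = g U) :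
    (∫⋯∫⁻_s, g ∂(fun _ : PBond P 0 => (HaarData.haar : Measure G))) = g := by
  classical
  haveI : IsProbabilityMeasure (HaarData.haar (G := G)) := HaarData.isProb
  induction s using Finset.induction_on with
  | empty => exact lmarginal_empty _ g
  | insert b s hb ih =>
    have hinv' : ∀ b' ∈ s, ∀ (U : PBond P 0 → G) (V : G), g (Function.update U b' V) = g U :=
      fun b' hb' => hinv b' (Finset.mem_insert_of_mem hb')
    rw [lmarginal_insert' _ hg hb]
    have h1 : (fun U : PBond P 0 → G => ∫⁻ V, g (Function.update U b V) ∂(HaarData.haar : Measure G)) = g := by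
      ext U
      simp_rw [hinv b (Finset.mem_insert_self b s)]
      rw [lintegral_const, measure_univ, mul_one]
    rw [h1]
    exact ih hinv'

/-- **★★★ PEELING WITH A SPECTATOR**: `∫⁻ (Π_{p∈𝔉} φ_β(U(∂p)))·Gs(U) dU ≤ linkMassE β ^ #𝔉 · ∫⁻ Gs dU` (indeed `=`) for a peelable family
and a measurable spectator `Gs` not depending on the pivots. [folklore] -/
theorem lintegral_prodPlaqFactor_mul_le_of_peelable (β : ℝ) (𝔉 : Finset (Plaq P 0)) (piv : Plaq P 0 → PBond P 0)
    (ρ : Plaq P 0 → ℕ)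
    (hlink : ∀ p ∈ 𝔉, piv p = ⟨p.src, p.μ⟩ ∨ piv p = ⟨p.src.shift p.μ, p.ν⟩ ∨ piv p = ⟨p.src.shift p.ν, p.μ⟩ ∨ piv p = ⟨p.src, p.ν⟩)
    (hinj : Set.InjOn piv (𝔉 : Set (Plaq P 0)))
    (hpriv : ∀ p ∈ 𝔉, ∀ q ∈ 𝔉, p ≠ q →
      (piv q = ⟨p.src, p.μ⟩ ∨ piv q = ⟨p.src.shift p.μ, p.ν⟩ ∨ piv q = ⟨p.src.shift p.ν, p.μ⟩ ∨ piv q = ⟨p.src, p.ν⟩) → ρ p < ρ q)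
    (Gs : GaugeField P 0 G → ℝ≥0∞) (hGm : Measurable Gs) (hGs : ∀ p ∈ 𝔉, ∀ (U : GaugeField P 0 G) (V : G), Gs (Function.update U (piv p) V) = Gs U) :
    ∫⁻ U, (∏ p ∈ 𝔉, ENNReal.ofReal (plaqFactor β (GaugeField.plaqHol U p))) * Gs U ∂fieldMeasure P 0 G ≤
      linkMassE (G := G) β ^ 𝔉.card * ∫⁻ U, Gs U ∂fieldMeasure P 0 G := by
  classical
  haveI : IsProbabilityMeasure (HaarData.haar (G := G)) := HaarData.isProb
  have hmeasF : Measurable fun U : GaugeField P 0 G =>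
      (∏ p ∈ 𝔉, ENNReal.ofReal (plaqFactor β (GaugeField.plaqHol U p))) * Gs U := (measurable_prodPlaqFactor P β _).mul hGm
  have hmeasR : Measurable fun U : GaugeField P 0 G => linkMassE (G := G) β ^ 𝔉.card * Gs U := hGm.const_mul _
  have heq := lmarginal_prodPlaqFactor_mul_eq_of_peelable P β 𝔉 piv ρ hlink hinj hpriv Gs hGm hGs 𝔉.card 𝔉 rfl subset_rfl
  have hinvR : ∀ b ∈ 𝔉.image piv, ∀ (U : PBond P 0 → G) (V : G),
      linkMassE (G := G) β ^ 𝔉.card * Gs (Function.update U b V) = linkMassE (G := G) β ^ 𝔉.card * Gs U := by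
    intro b hb U V
    obtain ⟨p, hp, rfl⟩ := Finset.mem_image.1 hb
    rw [hGs p hp U V]
  have hR := lmarginal_eq_self_of_invariant P (𝔉.image piv) (fun U => linkMassE (G := G) β ^ 𝔉.card * Gs U) hmeasR hinvR
  have hfg : (∫⋯∫⁻_(𝔉.image piv), (fun U : GaugeField P 0 G => (∏ p ∈ 𝔉, ENNReal.ofReal (plaqFactor β (GaugeField.plaqHol U p))) * Gs U)
        ∂(fun _ : PBond P 0 => (HaarData.haar : Measure G))) =
      ∫⋯∫⁻_(𝔉.image piv), (fun U : GaugeField P 0 G => linkMassE (G := G) β ^ 𝔉.card * Gs U)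
        ∂(fun _ : PBond P 0 => (HaarData.haar : Measure G)) := by
    rw [heq]; exact hR.symm
  have h := lintegral_eq_of_lmarginal_eq (μ := fun _ : PBond P 0 => (HaarData.haar : Measure G)) (𝔉.image piv) hmeasF hmeasR hfg
  calc ∫⁻ U, (∏ p ∈ 𝔉, ENNReal.ofReal (plaqFactor β (GaugeField.plaqHol U p))) * Gs U ∂fieldMeasure P 0 G
      = ∫⁻ U, (∏ p ∈ 𝔉, ENNReal.ofReal (plaqFactor β (GaugeField.plaqHol U p))) * Gs U
          ∂(Measure.pi fun _ : PBond P 0 => (HaarData.haar : Measure G)) := rfl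
    _ = ∫⁻ U, linkMassE (G := G) β ^ 𝔉.card * Gs U ∂(Measure.pi fun _ : PBond P 0 => (HaarData.haar : Measure G)) := h
    _ = linkMassE (G := G) β ^ 𝔉.card * ∫⁻ U, Gs U ∂(Measure.pi fun _ : PBond P 0 => (HaarData.haar : Measure G)) :=
        lintegral_const_mul _ hGm
    _ = linkMassE (G := G) β ^ 𝔉.card * ∫⁻ U, Gs U ∂fieldMeasure P 0 G := rfl
    _ ≤ linkMassE (G := G) β ^ 𝔉.card * ∫⁻ U, Gs U ∂fieldMeasure P 0 G := le_rfl

end Summit.QuantumFields.YangMills.Theorems.CoarseStiffnessTailSpectatorPeeling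

end
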